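import Summits.QuantumAdvantage.QuantumAdvantage.Theses.SymplecticPurity

/-!
# Disproof file for the crux `SymplecticPurity.CompositeFrameBound` (stmt-QuantumAdvantage-10730)

Standing adversary (cdisprove), generation 2 (refuter-cdisprove-stmt-QuantumAdvantage-10730-g2-0),
extending generation 1 (refuter-cdisprove-stmt-QuantumAdvantage-10730-0, evidence files
`Disproof.lean` / `PeelingConstruction.md` / `AncillaRefutation.md` / `Numerics.md` on the item; the
gen-1 Lean source is not readable from a gen-2 jail, so its theorems are RE-PROVED here under the
same names where the ledger notes describe them, and the file is now a crux WORKFILE in the tree).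
Prose lives in docstrings only. Everything is sorry-free, axioms ⊆ {propext, Classical.choice,
Quot.sound}.

THE CRUX. `∃ c>0 ∃ n₀ ∀ n ≥ n₀ ∀ K (|K| = 2ⁿ) ∀ e : K ≃+ 𝔽₂ⁿ ∀ U₁ U₂ (unitary, semantic Clifford)
∀ U (unitary, fermionic Gaussian): the state U₂ U U₁ ĝ has a linear cut {wires < k} of purity
≤ 2^{-cn}`, ĝ = 2^{-n/2} Σ_x |x⟩|x³⟩ the cube (Gold, almost-bent) data-loading state on n+n wires.

VERDICT SO FAR (gen 1 + gen 2): RESISTS; open in substance; no kill. See §4 for the attack ledger.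

## Findings (index)

* §0 `crux_iff` — the crux is DEFINITIONALLY the schema `FrameBound Clifford Clifford Gaussian`
  over the vocabulary `ghat`, `cutPurity`, `IsCliffordU`, `IsGaussianU` (Iff.rfl).
* §1 LOAD-BEARING (re-proved): `false_without_clifford₁`, `false_without_clifford₂`,
  `false_without_gaussian` — drop the STRUCTURE predicate of any one layer (keep unitarity) and the
  statement is false: that layer can be a full disentangler (`exists_unitary_ghat_to_zero`, an
  orthonormal-basis-extension unitary sending ĝ to |0…0⟩, all cuts purity 1 > 2^{-cn}).  Master
  lemma `not_frameBound_of_disentangler`.  The field/identification quantifiers are never vacuous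
  (`exists_field`: GaloisField 2 n).
* §2 TOOLKIT (re-proved): `ghat_append`, `sum_norm_sq_ghat` (‖ĝ‖² = 1), `star_ghat_dotProduct_ghat`,
  `cutPurity_basisState` (= 1 at every k), `isCliffordU_one`, `isGaussianU_one`,
  `exists_unitary_single_to`.
* §3 PURITY = SPECTRAL MASS (new, proved): `two_pow_mul_cutPurity`, `norm_cutPurity_eq` —
  `‖cutPurity ψ k‖ = 2^{-k} Σ_{S ∈ 𝒫^{<k}⊗I} |⟨ψ|S|ψ⟩|²` for the crux's literal 4-fold sum
  (`sum_stringsOn_low_apply_mul_star_apply` is the completeness kernel); reusable by 10729 provers.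
* §4 LAYERS ON SPECTRA (new, proved): `eq_of_pauliString_eq_smul`, `isCliffordU_star` (semantic
  Clifford is inverse-closed), `exists_relabel_of_isCliffordU` (`|⟨Uχ|T|Uχ⟩| = |⟨χ|gT|χ⟩|`, `g`
  injective, `g I = I`), `star_mulVec_dotProduct_mulVec`, `expect_mulVec_eq`.
* §5 U₂-FREE REDUCTION (new, proved): `norm_cutPurity_mulVec_le` (for unit `χ`, ANY Clifford `V`:
  `purity_k(Vχ) ≤ 2^{-k}(1 + bigMass_τ χ) + 2^k τ`), `crux_of_sparsePeakProfile :
  SparsePeakProfile → CompositeFrameBound`, `crux_of_sparsePeaks : SparsePeaks β γ → (β < 2γ,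
  β/2+γ ≤ 1) → CompositeFrameBound` with the cut arithmetic `profile_arith`.
* §6 PROSE: depth-1 rigidity of ĝ (`purity_k(Vĝ) ≤ 9·2^{-min(k,2n-k)}` for every Clifford `V`),
  the necessary mass-profile condition for any kill, the coset-transform structure of
  Clifford∘T-layer∘Clifford frames (explains gen 1's 1/√2 peel), why general SO(4n) is open,
  exact-disentangling constraints, typing remarks, attack ledger, lines for provers/planner.
-/

noncomputable section

set_option linter.dupNamespace false

namespace Summit.QuantumAdvantage.QuantumAdvantage.Cruxes.CompositeFrameBound.Disproof

open Literature.Computability.Cryptography Literature.Computability.QuantumComplexity Matrix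
open Summit.QuantumAdvantage.QuantumAdvantage.Theses.SymplecticPurity (CompositeFrameBound)

/-! ## §0 Vocabulary and the crux restated through it -/

/-- The normalised cube graph state `ĝ = 2^{-n/2} Σ_x |x⟩|x³⟩` on `n + n` wires, LITERALLY the
vector appearing in the crux (data wires `Fin.castAdd n i`, value wires `Fin.natAdd n j`). -/
def ghat (n : ℕ) (K : Type) [Field K] [Fintype K] (e : K ≃+ (Fin n → ZMod 2)) :
    QReg (n + n) → ℂ :=
  fun w : QReg (n + n) => if (fun j : Fin n => w (Fin.natAdd n j)) =
      (fun j : Fin n => decide (e ((e.symm (fun i : Fin n => if w (Fin.castAdd n i) then 1 else 0)) ^ 3) j = 1))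
    then ((Real.sqrt 2 ^ n)⁻¹ : ℂ) else 0

/-- The bits of `x³`, read through the identification `e`. -/
def cubeBits (n : ℕ) {K : Type} [Field K] (e : K ≃+ (Fin n → ZMod 2)) (x : QReg n) : QReg n :=
  fun j : Fin n => decide (e ((e.symm (fun i : Fin n => if x i then 1 else 0)) ^ 3) j = 1)

/-- The purity `Tr ρ²_{wires < k}` of the linear cut `{wires < k}` of a state vector `ψ`, written
as the crux writes it: the 4-fold agreement sum. -/
def cutPurity {N : ℕ} (ψ : QReg N → ℂ) (k : ℕ) : ℂ :=
  ∑ x₁ : QReg N, ∑ x₂ : QReg N, ∑ x₃ : QReg N, ∑ x₄ : QReg N,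
    (if (∀ i, k ≤ i.val → x₁ i = x₂ i) ∧ (∀ i, i.val < k → x₂ i = x₃ i) ∧
        (∀ i, k ≤ i.val → x₃ i = x₄ i) ∧ (∀ i, i.val < k → x₄ i = x₁ i)
      then ψ x₁ * star (ψ x₂) * ψ x₃ * star (ψ x₄) else 0)

/-- SEMANTIC Clifford unitary (the crux's typing of the outer layers): conjugation maps every
Pauli string to a unit-phase multiple of a Pauli string. (Unitarity is a separate hypothesis.) -/
def IsCliffordU {N : ℕ} (U : Matrix (QReg N) (QReg N) ℂ) : Prop :=
  ∀ S : Fin N → Pauli, ∃ S' : Fin N → Pauli, ∃ c : ℂ, ‖c‖ = 1 ∧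
    U * pauliString S * star U = c • pauliString S'

/-- Fermionic GAUSSIAN unitary (the crux's typing of the middle layer): conjugation rotates the
Jordan–Wigner Majoranas by a real orthogonal `R`. -/
def IsGaussianU {N : ℕ} (U : Matrix (QReg N) (QReg N) ℂ) : Prop :=
  ∃ R : Matrix (Fin N × Bool) (Fin N × Bool) ℝ, R * Rᵀ = 1 ∧
    ∀ p : Fin N × Bool, U * majorana N p.1 p.2 * star U =
      ∑ q : Fin N × Bool, (R p q : ℂ) • majorana N q.1 q.2

/-- The frame-bound SCHEMA: the crux with the three structure predicates of the layers
(`P₁` outer-right, `P₂` outer-left, `P` middle) as parameters; unitarity of each layer is kept. -/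
def FrameBound (P₁ P₂ P : (N : ℕ) → Matrix (QReg N) (QReg N) ℂ → Prop) : Prop :=
  ∃ c : ℝ, 0 < c ∧ ∃ n₀ : ℕ, ∀ n ≥ n₀, ∀ (K : Type) [Field K] [Fintype K], Fintype.card K = 2 ^ n →
    ∀ e : K ≃+ (Fin n → ZMod 2), ∀ U₁ U₂ U : Matrix (QReg (n + n)) (QReg (n + n)) ℂ,
      U₁ ∈ Matrix.unitaryGroup (QReg (n + n)) ℂ → P₁ (n + n) U₁ →
      U₂ ∈ Matrix.unitaryGroup (QReg (n + n)) ℂ → P₂ (n + n) U₂ →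
      U ∈ Matrix.unitaryGroup (QReg (n + n)) ℂ → P (n + n) U →
      ∃ k ≤ n + n, ‖cutPurity (U₂.mulVec (U.mulVec (U₁.mulVec (ghat n K e)))) k‖ ≤
        (2 : ℝ) ^ (-(c * (n : ℝ)))

/-- The crux IS the schema at (Clifford, Clifford, Gaussian) — definitionally. -/
theorem crux_iff :
    CompositeFrameBound ↔ FrameBound (fun _ => IsCliffordU) (fun _ => IsCliffordU) (fun _ => IsGaussianU) :=
  Iff.rfl


/-! ## §2 Toolkit: the cube state, basis states, fields, unitaries -/

/-- Amplitudes of `ĝ` on a split register `w = x ++ y`: `2^{-n/2}·[y = bits(x³)]`. -/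
theorem ghat_append {n : ℕ} {K : Type} [Field K] [Fintype K] (e : K ≃+ (Fin n → ZMod 2))
    (x y : QReg n) :
    ghat n K e (Fin.append x y) = if y = cubeBits n e x then ((Real.sqrt 2 ^ n)⁻¹ : ℂ) else 0 := by
  simp only [ghat, cubeBits, Fin.append_left, Fin.append_right, funext_iff]

/-- `‖ĝ‖² = 1`: exactly one value string per data string, `2ⁿ` strings of amplitude `2^{-n/2}`. -/
theorem sum_norm_sq_ghat {n : ℕ} {K : Type} [Field K] [Fintype K] (e : K ≃+ (Fin n → ZMod 2)) :
    ∑ w, ‖ghat n K e w‖ ^ 2 = 1 := by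
  have h1 : ∑ w, ‖ghat n K e w‖ ^ 2 =
      ∑ p : QReg n × QReg n, ‖ghat n K e (Fin.append p.1 p.2)‖ ^ 2 :=
    (Fintype.sum_equiv (Fin.appendEquiv n n) _ _ (fun _ => rfl)).symm
  have h2 : ∀ p : QReg n × QReg n, ‖ghat n K e (Fin.append p.1 p.2)‖ ^ 2 =
      if p.2 = cubeBits n e p.1 then ((2 : ℝ) ^ n)⁻¹ else 0 := by
    intro p
    rw [ghat_append]
    split_ifs
    · rw [norm_inv, norm_pow, Complex.norm_real, Real.norm_eq_abs,
        abs_of_nonneg (Real.sqrt_nonneg 2), inv_pow, ← pow_mul, mul_comm n 2, pow_mul,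
        Real.sq_sqrt (by norm_num : (0:ℝ) ≤ 2)]
    · simp
  rw [h1, Fintype.sum_congr _ _ h2, Fintype.sum_prod_type]
  simp only [Finset.sum_ite_eq', Finset.mem_univ, if_true, Finset.sum_const, Finset.card_univ,
    Fintype.card_fun, Fintype.card_bool, Fintype.card_fin, nsmul_eq_mul]
  push_cast
  exact mul_inv_cancel₀ (by positivity)

/-- `ĝ` as a star-dot-product unit vector. -/
theorem star_ghat_dotProduct_ghat {n : ℕ} {K : Type} [Field K] [Fintype K]
    (e : K ≃+ (Fin n → ZMod 2)) : star (ghat n K e) ⬝ᵥ ghat n K e = 1 := by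
  have h := congrArg ((↑) : ℝ → ℂ) (sum_norm_sq_ghat e)
  push_cast at h
  simpa only [dotProduct, Pi.star_apply, Complex.star_def, Complex.conj_mul'] using h

/-- Purity of every linear cut of a computational basis state is `1`. -/
theorem cutPurity_basisState {N : ℕ} (x : QReg N) (k : ℕ) : cutPurity (basisState x) k = 1 := by
  have key : ∀ x₁ x₂ x₃ x₄ : QReg N,
      (if (∀ i, k ≤ i.val → x₁ i = x₂ i) ∧ (∀ i, i.val < k → x₂ i = x₃ i) ∧
          (∀ i, k ≤ i.val → x₃ i = x₄ i) ∧ (∀ i, i.val < k → x₄ i = x₁ i)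
        then basisState x x₁ * star (basisState x x₂) * basisState x x₃ * star (basisState x x₄)
        else 0) =
      if x₄ = x then (if x₃ = x then (if x₂ = x then (if x₁ = x then (1 : ℂ) else 0) else 0)
        else 0) else 0 := by
    intro x₁ x₂ x₃ x₄
    by_cases h1 : x₁ = x <;> by_cases h2 : x₂ = x <;> by_cases h3 : x₃ = x <;>
      by_cases h4 : x₄ = x <;> simp [basisState_apply, h1, h2, h3, h4]
  simp only [cutPurity, key, Finset.sum_ite_eq', Finset.mem_univ, if_true]

/-- A field of order `2ⁿ` with an additive identification with `𝔽₂ⁿ` exists for every `n ≥ 1`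
(`GaloisField 2 n`): the crux's `∀ K ∀ e` is never vacuous. -/
theorem exists_field (n : ℕ) (hn : n ≠ 0) :
    ∃ (K : Type) (_ : Field K) (_ : Fintype K),
      Fintype.card K = 2 ^ n ∧ Nonempty (K ≃+ (Fin n → ZMod 2)) := by
  haveI : Fact (Nat.Prime 2) := ⟨Nat.prime_two⟩
  letI : Fintype (GaloisField 2 n) := Fintype.ofFinite _
  refine ⟨GaloisField 2 n, inferInstance, inferInstance, ?_, ?_⟩
  · rw [← Nat.card_eq_fintype_card]
    exact GaloisField.card 2 n hn
  · exact ⟨(Module.finBasisOfFinrankEq (ZMod 2) (GaloisField 2 n)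
      (GaloisField.finrank 2 hn)).equivFun.toAddEquiv⟩

/-- Every unit vector is the image of a basis vector under some unitary (orthonormal-basis
extension; the ten-line Mathlib argument of `RandomizedQuerySimulation.exists_unitary_mulVec_single_eq`,
re-proved here to keep the import cone at the route file). -/
theorem exists_unitary_single_to {B : Type*} [Fintype B] [DecidableEq B] (s : B)
    (v : B → ℂ) (hv : ∑ i, ‖v i‖ ^ 2 = 1) :
    ∃ U : Matrix.unitaryGroup B ℂ, (U : Matrix B B ℂ) *ᵥ Pi.single s 1 = v := by
  have hw : ‖(WithLp.toLp 2 v : EuclideanSpace ℂ B)‖ = 1 := by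
    rw [EuclideanSpace.norm_eq]
    simp [hv]
  have hon : Orthonormal ℂ (({s} : Set B).restrict fun _ : B =>
      (WithLp.toLp 2 v : EuclideanSpace ℂ B)) := by
    rw [orthonormal_subsingleton_iff]
    intro _
    exact hw
  obtain ⟨b, hb⟩ := Orthonormal.exists_orthonormalBasis_extension_of_card_eq (𝕜 := ℂ)
    (E := EuclideanSpace ℂ B) finrank_euclideanSpace hon
  refine ⟨⟨(EuclideanSpace.basisFun B ℂ).toBasis.toMatrix b,
    (EuclideanSpace.basisFun B ℂ).toMatrix_orthonormalBasis_mem_unitary b⟩, ?_⟩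
  funext i
  rw [Matrix.mulVec_single_one]
  simp [Matrix.col, Module.Basis.toMatrix_apply, hb s (Set.mem_singleton s)]

/-- A DISENTANGLING UNITARY for `ĝ`: some unitary maps `ĝ` to the basis state `|0…0⟩`
(all its linear cuts then have purity `1`). This is the witness behind all of §1. -/
theorem exists_unitary_ghat_to_zero {n : ℕ} {K : Type} [Field K] [Fintype K]
    (e : K ≃+ (Fin n → ZMod 2)) :
    ∃ V ∈ Matrix.unitaryGroup (QReg (n + n)) ℂ, V *ᵥ ghat n K e = zeroState (n + n) := by
  obtain ⟨U, hU⟩ := exists_unitary_single_to (fun _ : Fin (n + n) => false) (ghat n K e)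
    (sum_norm_sq_ghat e)
  refine ⟨star (U : Matrix (QReg (n + n)) (QReg (n + n)) ℂ), ?_, ?_⟩
  · exact Unitary.star_mem U.prop
  · rw [← hU, Matrix.mulVec_mulVec, Matrix.UnitaryGroup.star_mul_self, Matrix.one_mulVec]
    rfl

/-- The identity is a (semantic) Clifford unitary. -/
theorem isCliffordU_one (N : ℕ) : IsCliffordU (1 : Matrix (QReg N) (QReg N) ℂ) := by
  intro S
  exact ⟨S, 1, by simp, by simp⟩

/-- The identity is a Gaussian unitary (`R = 1`). -/
theorem isGaussianU_one (N : ℕ) : IsGaussianU (1 : Matrix (QReg N) (QReg N) ℂ) := by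
  refine ⟨1, by simp, fun p => ?_⟩
  simp only [Matrix.one_mul, star_one, Matrix.mul_one, Matrix.one_apply]
  simp only [apply_ite ((↑) : ℝ → ℂ), Complex.ofReal_one, Complex.ofReal_zero, ite_smul,
    one_smul, zero_smul, Finset.sum_ite_eq, Finset.mem_univ, if_true]

/-! ## §1 Load-bearing analysis: every layer's STRUCTURE hypothesis is necessary

Drop the structure predicate of any one layer (keeping its unitarity) and the statement is
false: that layer can then be a full disentangler of `ĝ`. Hence ANY proof of the crux must use the
Clifford property of `U₁`, the Clifford property of `U₂` AND the Gaussian property of `U`. -/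

/-- Master lemma: a schema that admits, for every `n ≥ 1`, field and identification, a frame
inside its three predicates mapping `ĝ` to a computational basis state, is false. -/
theorem not_frameBound_of_disentangler {P₁ P₂ P : (N : ℕ) → Matrix (QReg N) (QReg N) ℂ → Prop}
    (h : ∀ n : ℕ, 1 ≤ n → ∀ (K : Type) [Field K] [Fintype K], Fintype.card K = 2 ^ n →
      ∀ e : K ≃+ (Fin n → ZMod 2), ∃ U₁ U₂ U : Matrix (QReg (n + n)) (QReg (n + n)) ℂ,
        U₁ ∈ Matrix.unitaryGroup (QReg (n + n)) ℂ ∧ P₁ (n + n) U₁ ∧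
        U₂ ∈ Matrix.unitaryGroup (QReg (n + n)) ℂ ∧ P₂ (n + n) U₂ ∧
        U ∈ Matrix.unitaryGroup (QReg (n + n)) ℂ ∧ P (n + n) U ∧
        ∃ x : QReg (n + n), U₂ *ᵥ (U *ᵥ (U₁ *ᵥ ghat n K e)) = basisState x) :
    ¬ FrameBound P₁ P₂ P := by
  rintro ⟨c, hc, n₀, H⟩
  obtain ⟨K, iF, iT, hK, ⟨e⟩⟩ := exists_field (max n₀ 1) (by omega)
  obtain ⟨U₁, U₂, U, h1, p1, h2, p2, h3, p3, x, hx⟩ :=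
    h (max n₀ 1) (le_max_right _ _) K hK e
  obtain ⟨k, -, hk⟩ := H (max n₀ 1) (le_max_left _ _) K hK e U₁ U₂ U h1 p1 h2 p2 h3 p3
  rw [hx, cutPurity_basisState, norm_one] at hk
  have : (2 : ℝ) ^ (-(c * ((max n₀ 1 : ℕ) : ℝ))) < 1 :=
    Real.rpow_lt_one_of_one_lt_of_neg (by norm_num) (by
      have : (1 : ℝ) ≤ ((max n₀ 1 : ℕ) : ℝ) := by exact_mod_cast le_max_right n₀ 1
      nlinarith)
  linarith

/-- The crux with the Clifford hypothesis on `U₁` dropped (unitarity kept). -/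
def WithoutClifford₁ : Prop := FrameBound (fun _ _ => True) (fun _ => IsCliffordU) (fun _ => IsGaussianU)

/-- The crux with the Clifford hypothesis on `U₂` dropped (unitarity kept). -/
def WithoutClifford₂ : Prop := FrameBound (fun _ => IsCliffordU) (fun _ _ => True) (fun _ => IsGaussianU)

/-- The crux with the Gaussian hypothesis on `U` dropped (unitarity kept). -/
def WithoutGaussian : Prop := FrameBound (fun _ => IsCliffordU) (fun _ => IsCliffordU) (fun _ _ => True)

/-- ANY PROOF MUST USE that `U₁` is Clifford: without it `U₁` may be a disentangler. -/
theorem false_without_clifford₁ : ¬ WithoutClifford₁ := by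
  refine not_frameBound_of_disentangler fun n _ K _ _ _ e => ?_
  obtain ⟨V, hV, hVg⟩ := exists_unitary_ghat_to_zero e
  refine ⟨V, 1, 1, hV, trivial, Submonoid.one_mem _, isCliffordU_one _, Submonoid.one_mem _,
    isGaussianU_one _, fun _ => false, ?_⟩
  rw [hVg, Matrix.one_mulVec, Matrix.one_mulVec]
  rfl

/-- ANY PROOF MUST USE that `U₂` is Clifford: without it `U₂` may be a disentangler. -/
theorem false_without_clifford₂ : ¬ WithoutClifford₂ := by
  refine not_frameBound_of_disentangler fun n _ K _ _ _ e => ?_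
  obtain ⟨V, hV, hVg⟩ := exists_unitary_ghat_to_zero e
  refine ⟨1, V, 1, Submonoid.one_mem _, isCliffordU_one _, hV, trivial, Submonoid.one_mem _,
    isGaussianU_one _, fun _ => false, ?_⟩
  rw [Matrix.one_mulVec, Matrix.one_mulVec, hVg]
  rfl

/-- ANY PROOF MUST USE that `U` is Gaussian: without it `U` may be a disentangler. -/
theorem false_without_gaussian : ¬ WithoutGaussian := by
  refine not_frameBound_of_disentangler fun n _ K _ _ _ e => ?_
  obtain ⟨V, hV, hVg⟩ := exists_unitary_ghat_to_zero e
  refine ⟨1, 1, V, Submonoid.one_mem _, isCliffordU_one _, Submonoid.one_mem _, isCliffordU_one _,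
    hV, trivial, fun _ => false, ?_⟩
  rw [Matrix.one_mulVec, Matrix.one_mulVec, hVg]
  rfl


/-! ## §3 Purity is Pauli spectral mass on the cut (gen 2; reusable by the provers of 10729)

`2^k · Tr ρ²_{wires<k}(ψ) = Σ_{S ∈ 𝒫^{<k} ⊗ I} |⟨ψ|S|ψ⟩|²` for EVERY vector `ψ` — the identity
"purity = spectral mass on the cut" (KempeEtAl2010 Observation 3 + Parseval), proved here directly
for the crux's 4-fold agreement sum by the entrywise completeness of the Pauli strings on the low
wires. -/

/-- The low wires `{i : i < k}` of an `N`-wire register. -/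
def lowWires (N k : ℕ) : Finset (Fin N) := Finset.univ.filter fun i : Fin N => i.val < k

theorem mem_lowWires {N k : ℕ} {i : Fin N} : i ∈ lowWires N k ↔ i.val < k := by
  simp [lowWires]

theorem card_lowWires {N k : ℕ} (hk : k ≤ N) : (lowWires N k).card = k := by
  have : lowWires N k = Finset.univ.map (Fin.castLEEmb hk) := by
    ext i
    simp only [lowWires, Finset.mem_filter, Finset.mem_univ, true_and, Finset.mem_map]
    constructor
    · intro hi
      exact ⟨⟨i, hi⟩, Fin.ext rfl⟩
    · rintro ⟨j, rfl⟩
      exact j.2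
  rw [this, Finset.card_map, Finset.card_univ, Fintype.card_fin]

/-- `|𝒫^W| = 4^{|W|}`. -/
theorem card_stringsOn {N : ℕ} (W : Finset (Fin N)) : (stringsOn W).card = 4 ^ W.card := by
  rw [stringsOn, Fintype.card_piFinset]
  have : ∀ i : Fin N, (if i ∈ W then (Finset.univ : Finset Pauli) else {Pauli.I}).card =
      if i ∈ W then 4 else 1 := by
    intro i
    split_ifs
    · rw [Finset.card_univ, Pauli.card_univ]
    · rfl
  simp only [this, Finset.prod_ite, Finset.prod_const]
  simp

/-- The Pauli EXPECTATION `⟨ψ|S|ψ⟩` of a string in a vector. -/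
def expect {N : ℕ} (ψ : QReg N → ℂ) (S : Fin N → Pauli) : ℂ := star ψ ⬝ᵥ (pauliString S *ᵥ ψ)

/-- Entrywise completeness of the strings on the low wires, for ARBITRARY labels:
`Σ_{S ∈ 𝒫^{<k} ⊗ I} S_{x₂x₁} conj(S_{x₃x₄}) = 2^k · [the four agreement conditions of cutPurity]`. -/
theorem sum_stringsOn_low_apply_mul_star_apply {N : ℕ} {k : ℕ} (hk : k ≤ N)
    (x₁ x₂ x₃ x₄ : QReg N) :
    ∑ S ∈ stringsOn (lowWires N k), pauliString S x₂ x₁ * star (pauliString S x₃ x₄) =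
      if (∀ i, k ≤ i.val → x₁ i = x₂ i) ∧ (∀ i, i.val < k → x₂ i = x₃ i) ∧
          (∀ i, k ≤ i.val → x₃ i = x₄ i) ∧ (∀ i, i.val < k → x₄ i = x₁ i)
      then (2 : ℂ) ^ k else 0 := by
  have hstar : ∀ S : Fin N → Pauli, star (pauliString S x₃ x₄) = pauliString S x₄ x₃ :=
    fun S => by
      have := congrFun (congrFun (conjTranspose_pauliString S) x₄) x₃
      rwa [Matrix.conjTranspose_apply] at this
  simp only [hstar]
  simp only [pauliString_eq, tensorAll_apply, ← Finset.prod_mul_distrib, stringsOn]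
  rw [← Finset.prod_univ_sum (fun i => if i ∈ lowWires N k then Finset.univ else {Pauli.I})
    (fun i Q => Pauli.mat Q (x₂ i) (x₁ i) * Pauli.mat Q (x₄ i) (x₃ i))]
  have key : ∀ i : Fin N, (∑ Q ∈ (if i ∈ lowWires N k then Finset.univ else {Pauli.I}),
      Pauli.mat Q (x₂ i) (x₁ i) * Pauli.mat Q (x₄ i) (x₃ i)) =
      if (k ≤ i.val → x₂ i = x₁ i ∧ x₄ i = x₃ i) ∧ (i.val < k → x₂ i = x₃ i ∧ x₁ i = x₄ i)
      then (if i.val < k then 2 else 1) else 0 := by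
    intro i
    by_cases hi : i.val < k
    · have hi' : ¬ k ≤ i.val := not_le.mpr hi
      rw [if_pos (mem_lowWires.mpr hi), Pauli.sum_mat_mul_mat]
      simp only [hi', false_implies, true_and, hi, true_implies, if_true]
    · have hi' : k ≤ i.val := not_lt.mp hi
      rw [if_neg (fun h => hi (mem_lowWires.mp h)), Finset.sum_singleton]
      simp only [Pauli.mat_I_apply, hi', true_implies, hi, false_implies, and_true, if_false]
      by_cases h1 : x₂ i = x₁ i <;> by_cases h2 : x₄ i = x₃ i <;> simp [h1, h2]
  simp only [key, Fintype.prod_ite_zero]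
  have hprod : (∏ i : Fin N, (if i.val < k then (2 : ℂ) else 1)) = 2 ^ k := by
    rw [Finset.prod_ite, Finset.prod_const_one, mul_one, Finset.prod_const]
    congr 1
    exact card_lowWires hk
  rw [hprod]
  by_cases h : (∀ i, k ≤ i.val → x₁ i = x₂ i) ∧ (∀ i, i.val < k → x₂ i = x₃ i) ∧
      (∀ i, k ≤ i.val → x₃ i = x₄ i) ∧ (∀ i, i.val < k → x₄ i = x₁ i)
  · rw [if_pos h, if_pos]
    intro i
    exact ⟨fun hi => ⟨(h.1 i hi).symm, (h.2.2.1 i hi).symm⟩,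
      fun hi => ⟨h.2.1 i hi, (h.2.2.2 i hi).symm⟩⟩
  · rw [if_neg h, if_neg]
    intro h'
    exact h ⟨fun i hi => ((h' i).1 hi).1.symm, fun i hi => ((h' i).2 hi).1,
      fun i hi => ((h' i).1 hi).2.symm, fun i hi => ((h' i).2 hi).2.symm⟩

/-- Expansion of an expectation into matrix entries. -/
theorem expect_eq_sum {N : ℕ} (ψ : QReg N → ℂ) (S : Fin N → Pauli) :
    expect ψ S = ∑ a, ∑ b, star (ψ a) * (pauliString S a b * ψ b) := by
  simp only [expect, dotProduct, Matrix.mulVec, Pi.star_apply, Finset.mul_sum]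

/-- **Purity = spectral mass on the cut** (4-fold-sum form):
`2^k · cutPurity ψ k = Σ_{S ∈ 𝒫^{<k} ⊗ I} ⟨ψ|S|ψ⟩ · conj ⟨ψ|S|ψ⟩`, for every vector `ψ` and `k ≤ N`. -/
theorem two_pow_mul_cutPurity {N : ℕ} (ψ : QReg N → ℂ) {k : ℕ} (hk : k ≤ N) :
    (2 : ℂ) ^ k * cutPurity ψ k =
      ∑ S ∈ stringsOn (lowWires N k), expect ψ S * star (expect ψ S) := by
  have lhs : (2 : ℂ) ^ k * cutPurity ψ k = ∑ x₁, ∑ x₂, ∑ x₃, ∑ x₄,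
      star (ψ x₂) * ψ x₁ * (ψ x₃ * star (ψ x₄)) *
        (if (∀ i, k ≤ i.val → x₁ i = x₂ i) ∧ (∀ i, i.val < k → x₂ i = x₃ i) ∧
            (∀ i, k ≤ i.val → x₃ i = x₄ i) ∧ (∀ i, i.val < k → x₄ i = x₁ i)
          then (2 : ℂ) ^ k else 0) := by
    simp only [cutPurity, Finset.mul_sum]
    refine Finset.sum_congr rfl fun x₁ _ => Finset.sum_congr rfl fun x₂ _ =>
      Finset.sum_congr rfl fun x₃ _ => Finset.sum_congr rfl fun x₄ _ => ?_
    split_ifs <;> ring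
  have rhs : ∀ S : Fin N → Pauli, expect ψ S * star (expect ψ S) =
      ∑ x₂, ∑ x₁, ∑ x₃, ∑ x₄, star (ψ x₂) * ψ x₁ * (ψ x₃ * star (ψ x₄)) *
        (pauliString S x₂ x₁ * star (pauliString S x₃ x₄)) := by
    intro S
    rw [expect_eq_sum]
    simp only [star_sum, star_mul', star_star, Finset.sum_mul_sum]
    refine Finset.sum_congr rfl fun x₂ _ => ?_
    rw [Finset.sum_comm]
    refine Finset.sum_congr rfl fun x₁ _ => Finset.sum_congr rfl fun x₃ _ =>
      Finset.sum_congr rfl fun x₄ _ => ?_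
    ring
  rw [lhs, Finset.sum_congr rfl fun S _ => rhs S]
  conv_lhs => rw [Finset.sum_comm]
  conv_rhs => rw [Finset.sum_comm]
  refine Finset.sum_congr rfl fun x₂ _ => ?_
  conv_rhs => rw [Finset.sum_comm]
  refine Finset.sum_congr rfl fun x₁ _ => ?_
  conv_rhs => rw [Finset.sum_comm]
  refine Finset.sum_congr rfl fun x₃ _ => ?_
  conv_rhs => rw [Finset.sum_comm]
  refine Finset.sum_congr rfl fun x₄ _ => ?_
  rw [← Finset.mul_sum, sum_stringsOn_low_apply_mul_star_apply hk]

/-- **Purity = spectral mass on the cut** (norm form):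
`‖cutPurity ψ k‖ = 2^{-k} Σ_{S ∈ 𝒫^{<k} ⊗ I} |⟨ψ|S|ψ⟩|²`. -/
theorem norm_cutPurity_eq {N : ℕ} (ψ : QReg N → ℂ) {k : ℕ} (hk : k ≤ N) :
    ‖cutPurity ψ k‖ = ((2 : ℝ) ^ k)⁻¹ * ∑ S ∈ stringsOn (lowWires N k), ‖expect ψ S‖ ^ 2 := by
  have h := two_pow_mul_cutPurity ψ hk
  have h2 : cutPurity ψ k = ((2 : ℂ) ^ k)⁻¹ * ∑ S ∈ stringsOn (lowWires N k),
      expect ψ S * star (expect ψ S) := by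
    rw [← h, ← mul_assoc, inv_mul_cancel₀ (pow_ne_zero _ two_ne_zero), one_mul]
  have h3 : ∀ S, expect ψ S * star (expect ψ S) = ((‖expect ψ S‖ ^ 2 : ℝ) : ℂ) := by
    intro S
    rw [Complex.star_def, Complex.mul_conj, Complex.normSq_eq_norm_sq, Complex.ofReal_pow]
  rw [h2]
  simp only [h3]
  rw [← Complex.ofReal_sum]
  rw [norm_mul, norm_inv, norm_pow, Complex.norm_ofNat, Complex.norm_real, Real.norm_eq_abs,
    abs_of_nonneg (Finset.sum_nonneg fun S _ => sq_nonneg _)]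

/-! ## §4 How the outer layers act on spectra: Clifford relabelling, unitarity (gen 2) -/

/-- Distinct Pauli strings are never proportional (trace orthogonality). -/
theorem eq_of_pauliString_eq_smul {N : ℕ} {S T : Fin N → Pauli} {c : ℂ}
    (h : pauliString S = c • pauliString T) : S = T := by
  by_contra hne
  have h1 := congrArg (fun M => (M * pauliString S).trace) h
  simp only [Matrix.smul_mul, Matrix.trace_smul, pauliString_mul_self, Matrix.trace_one,
    trace_pauliString_mul_pauliString, if_neg (Ne.symm hne), smul_zero] at h1
  have : (Fintype.card (QReg N) : ℂ) ≠ 0 := by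
    rw [Fintype.card_fun, Fintype.card_bool, Fintype.card_fin]
    exact_mod_cast pow_ne_zero N two_ne_zero
  exact this h1

/-- Conjugating back through a unitary. -/
theorem star_mul_conj_mul {N : ℕ} {U : Matrix (QReg N) (QReg N) ℂ}
    (hu : U ∈ Matrix.unitaryGroup (QReg N) ℂ) (M : Matrix (QReg N) (QReg N) ℂ) :
    star U * (U * M * star U) * U = M := by
  have h1 : star U * U = 1 := Unitary.star_mul_self_of_mem hu
  calc star U * (U * M * star U) * U = (star U * U) * M * (star U * U) := by
        simp only [Matrix.mul_assoc]
    _ = M := by rw [h1, Matrix.one_mul, Matrix.mul_one]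

/-- The semantic Clifford property passes to the inverse `U† = star U`: the relabelling
`S ↦ S'` is injective (distinct strings are not proportional), hence bijective on the finite set
of strings. (So the crux's one-sided typing of the Clifford layers loses nothing.) -/
theorem isCliffordU_star {N : ℕ} {U : Matrix (QReg N) (QReg N) ℂ} (hU : IsCliffordU U)
    (hu : U ∈ Matrix.unitaryGroup (QReg N) ℂ) : IsCliffordU (star U) := by
  classical
  choose f c hc hf using hU
  have back : ∀ S, pauliString S = c S • (star U * pauliString (f S) * U) := by
    intro S
    calc pauliString S = star U * (U * pauliString S * star U) * U :=
          (star_mul_conj_mul hu _).symm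
      _ = c S • (star U * pauliString (f S) * U) := by
          rw [hf S, Matrix.mul_smul, Matrix.smul_mul]
  have hc0 : ∀ S, c S ≠ 0 := fun S h0 => by simpa [h0] using hc S
  have hX : ∀ S, star U * pauliString (f S) * U = (c S)⁻¹ • pauliString S := by
    intro S
    rw [back S, smul_smul, inv_mul_cancel₀ (hc0 S), one_smul]
  have finj : Function.Injective f := by
    intro S₁ S₂ h12
    have e1 := back S₁
    rw [h12, hX S₂, smul_smul] at e1
    exact eq_of_pauliString_eq_smul e1
  have fsurj : Function.Surjective f := Finite.surjective_of_injective finj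
  intro T
  obtain ⟨S, rfl⟩ := fsurj T
  refine ⟨S, (c S)⁻¹, by rw [norm_inv, hc S, inv_one], ?_⟩
  rw [star_star]
  exact hX S

/-- Unitaries preserve the norm `star v ⬝ᵥ v`. -/
theorem star_mulVec_dotProduct_mulVec {N : ℕ} {U : Matrix (QReg N) (QReg N) ℂ}
    (hu : U ∈ Matrix.unitaryGroup (QReg N) ℂ) (v : QReg N → ℂ) :
    star (U *ᵥ v) ⬝ᵥ (U *ᵥ v) = star v ⬝ᵥ v := by
  rw [Matrix.star_mulVec, ← Matrix.dotProduct_mulVec, Matrix.mulVec_mulVec,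
    ← Matrix.star_eq_conjTranspose, Unitary.star_mul_self_of_mem hu, Matrix.one_mulVec]

/-- The expectation of the identity string is the squared norm. -/
theorem expect_const_I {N : ℕ} (χ : QReg N → ℂ) :
    expect χ (fun _ => Pauli.I) = star χ ⬝ᵥ χ := by
  rw [expect, pauliString_const_I, Matrix.one_mulVec]

/-- Expectations transform COVARIANTLY under conjugation of the observable. -/
theorem expect_mulVec_eq {N : ℕ} (U : Matrix (QReg N) (QReg N) ℂ) (χ : QReg N → ℂ)
    (T : Fin N → Pauli) :
    expect (U *ᵥ χ) T = star χ ⬝ᵥ ((star U * pauliString T * U) *ᵥ χ) := by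
  rw [expect, Matrix.star_mulVec, ← Matrix.dotProduct_mulVec, Matrix.mulVec_mulVec,
    Matrix.mulVec_mulVec, ← Matrix.star_eq_conjTranspose, Matrix.mul_assoc]

/-- Through a Clifford unitary the Pauli spectrum is merely RELABELLED:
`|⟨Uχ|T|Uχ⟩| = |⟨χ|g T|χ⟩|` for an injective relabelling `g` fixing the identity string. -/
theorem exists_relabel_of_isCliffordU {N : ℕ} {U : Matrix (QReg N) (QReg N) ℂ}
    (hU : IsCliffordU U) (hu : U ∈ Matrix.unitaryGroup (QReg N) ℂ) :
    ∃ g : (Fin N → Pauli) → (Fin N → Pauli), Function.Injective g ∧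
      g (fun _ => Pauli.I) = (fun _ => Pauli.I) ∧
      ∀ (χ : QReg N → ℂ) (T : Fin N → Pauli), ‖expect (U *ᵥ χ) T‖ = ‖expect χ (g T)‖ := by
  classical
  have hu' : star U ∈ Matrix.unitaryGroup (QReg N) ℂ := Unitary.star_mem hu
  choose g c hc hg using isCliffordU_star hU hu
  simp only [star_star] at hg
  -- hg T : star U * pauliString T * U = c T • pauliString (g T)
  have hc0 : ∀ T, c T ≠ 0 := fun T h0 => by simpa [h0] using hc T
  have back : ∀ T, pauliString T = c T • (U * pauliString (g T) * star U) := by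
    intro T
    have h := star_mul_conj_mul hu' (pauliString T)
    rw [star_star] at h
    calc pauliString T = U * (star U * pauliString T * U) * star U := h.symm
      _ = c T • (U * pauliString (g T) * star U) := by
          rw [hg T, Matrix.mul_smul, Matrix.smul_mul]
  have hX : ∀ T, U * pauliString (g T) * star U = (c T)⁻¹ • pauliString T := by
    intro T
    rw [back T, smul_smul, inv_mul_cancel₀ (hc0 T), one_smul]
  refine ⟨g, ?_, ?_, ?_⟩
  · intro T₁ T₂ h12
    have e1 := back T₁
    rw [h12, hX T₂, smul_smul] at e1
    exact eq_of_pauliString_eq_smul e1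
  · have h := hg (fun _ => Pauli.I)
    rw [pauliString_const_I, Matrix.mul_one, Unitary.star_mul_self_of_mem hu,
      ← pauliString_const_I] at h
    exact (eq_of_pauliString_eq_smul h).symm
  · intro χ T
    rw [expect_mulVec_eq, hg T, Matrix.smul_mulVec, dotProduct_smul, smul_eq_mul,
      norm_mul, hc T, one_mul]
    rfl

/-! ## §5 A U₂-FREE SUFFICIENT CONDITION for the crux (gen 2; the line provers should take)

The flatness route (Gaussian images of ĝ stay 2^{-cn}-flat, then 10729) is DEAD (gen 1: explicit
Clifford∘T-layer frames give an exact `|⟨P⟩| = 1/√2` peak).  But the crux needs much less than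
flatness: by §3 and the relabelling of §4, for ANY Clifford `U₂` and any cut `k`,
`purity_k(U₂ χ) ≤ 2^{-k}·(1 + bigMass_τ(χ)) + 2^k·τ`, where `bigMass_τ(χ)` is the squared
spectral mass of `χ = U U₁ ĝ` on non-identity strings with `|⟨S⟩|² > τ` — the symplectic flag
chosen by `U₂` is paid for by the crude count `|𝒫^{<k}| = 4^k`.  Hence the crux follows from
`SparsePeakProfile` below, a statement about ONE Clifford and ONE Gaussian layer (O(1) peaks of
height O(1), as produced by peeling, are harmless to it; what would kill it is 2^{Ω(n)} strings of
squared expectation 2^{-n/2+Ω(n)}·… simultaneously — see the header for the exact trade-off). -/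

/-- Squared spectral mass of the LARGE non-identity expectations (`|⟨S⟩|² > τ`). -/
def bigMass {N : ℕ} (χ : QReg N → ℂ) (τ : ℝ) : ℝ :=
  ∑ S ∈ Finset.univ.filter (fun S : Fin N → Pauli => S ≠ (fun _ => Pauli.I) ∧ τ < ‖expect χ S‖ ^ 2),
    ‖expect χ S‖ ^ 2

theorem bigMass_nonneg {N : ℕ} (χ : QReg N → ℂ) (τ : ℝ) : 0 ≤ bigMass χ τ :=
  Finset.sum_nonneg fun _ _ => sq_nonneg _

/-- **The frame-independent purity bound.** For a unit vector `χ`, ANY semantic-Clifford unitary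
`V`, any cut `k ≤ N` and threshold `τ ≥ 0`:
`purity_k(Vχ) ≤ 2^{-k}(1 + bigMass_τ(χ)) + 2^k τ`. -/
theorem norm_cutPurity_mulVec_le {N : ℕ} (χ : QReg N → ℂ) (hχ : star χ ⬝ᵥ χ = 1)
    {V : Matrix (QReg N) (QReg N) ℂ} (hV : IsCliffordU V) (hv : V ∈ Matrix.unitaryGroup (QReg N) ℂ)
    {k : ℕ} (hk : k ≤ N) {τ : ℝ} (hτ : 0 ≤ τ) :
    ‖cutPurity (V *ᵥ χ) k‖ ≤ ((2 : ℝ) ^ k)⁻¹ * (1 + bigMass χ τ) + (2 : ℝ) ^ k * τ := by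
  classical
  obtain ⟨g, ginj, gI, hg⟩ := exists_relabel_of_isCliffordU hV hv
  set I₀ : Fin N → Pauli := fun _ => Pauli.I with hI₀
  set F : (Fin N → Pauli) → ℝ := fun S => ‖expect χ S‖ ^ 2 with hF
  have hFnn : ∀ S, 0 ≤ F S := fun S => sq_nonneg _
  rw [norm_cutPurity_eq _ hk]
  have hsum : ∑ T ∈ stringsOn (lowWires N k), ‖expect (V *ᵥ χ) T‖ ^ 2 =
      ∑ S ∈ (stringsOn (lowWires N k)).image g, F S := by
    rw [Finset.sum_image (fun _ _ _ _ h => ginj h)]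
    exact Finset.sum_congr rfl fun T _ => by rw [hg χ T]
  rw [hsum]
  set 𝒯 := (stringsOn (lowWires N k)).image g with h𝒯
  have hcard : 𝒯.card ≤ 4 ^ k := by
    calc 𝒯.card ≤ (stringsOn (lowWires N k)).card := Finset.card_image_le
      _ = 4 ^ k := by rw [card_stringsOn, card_lowWires hk]
  -- split the sum three ways
  have split : ∑ S ∈ 𝒯, F S =
      ∑ S ∈ 𝒯.filter (fun S => S = I₀), F S +
      (∑ S ∈ (𝒯.filter (fun S => ¬ S = I₀)).filter (fun S => τ < F S), F S +
       ∑ S ∈ (𝒯.filter (fun S => ¬ S = I₀)).filter (fun S => ¬ τ < F S), F S) := by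
    rw [Finset.sum_filter_add_sum_filter_not, Finset.sum_filter_add_sum_filter_not]
  have part1 : ∑ S ∈ 𝒯.filter (fun S => S = I₀), F S ≤ 1 := by
    calc ∑ S ∈ 𝒯.filter (fun S => S = I₀), F S ≤ ∑ S ∈ {I₀}, F S := by
          apply Finset.sum_le_sum_of_subset_of_nonneg
          · intro S hS
            rw [Finset.mem_filter] at hS
            rw [Finset.mem_singleton]
            exact hS.2
          · exact fun S _ _ => hFnn S
      _ = 1 := by
          rw [Finset.sum_singleton, hF, hI₀]
          simp only
          rw [expect_const_I, hχ, norm_one, one_pow]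
  have part2 : ∑ S ∈ (𝒯.filter (fun S => ¬ S = I₀)).filter (fun S => τ < F S), F S ≤
      bigMass χ τ := by
    apply Finset.sum_le_sum_of_subset_of_nonneg
    · intro S hS
      simp only [Finset.mem_filter] at hS
      simp only [Finset.mem_filter, Finset.mem_univ, true_and]
      exact ⟨hS.1.2, hS.2⟩
    · exact fun S _ _ => hFnn S
  have part3 : ∑ S ∈ (𝒯.filter (fun S => ¬ S = I₀)).filter (fun S => ¬ τ < F S), F S ≤
      (4 : ℝ) ^ k * τ := by
    calc ∑ S ∈ (𝒯.filter (fun S => ¬ S = I₀)).filter (fun S => ¬ τ < F S), F S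
        ≤ ∑ S ∈ (𝒯.filter (fun S => ¬ S = I₀)).filter (fun S => ¬ τ < F S), τ :=
          Finset.sum_le_sum fun S hS => by
            simp only [Finset.mem_filter] at hS
            exact not_lt.mp hS.2
      _ = ((𝒯.filter (fun S => ¬ S = I₀)).filter (fun S => ¬ τ < F S)).card • τ :=
          Finset.sum_const _
      _ ≤ (4 : ℝ) ^ k * τ := by
          rw [nsmul_eq_mul]
          apply mul_le_mul_of_nonneg_right _ hτ
          calc (((𝒯.filter (fun S => ¬ S = I₀)).filter (fun S => ¬ τ < F S)).card : ℝ)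
              ≤ 𝒯.card := by
                exact_mod_cast (Finset.card_filter_le _ _).trans (Finset.card_filter_le _ _)
            _ ≤ 4 ^ k := by exact_mod_cast hcard
  have h2k : (0 : ℝ) < 2 ^ k := pow_pos two_pos k
  have h42 : (4 : ℝ) ^ k = 2 ^ k * 2 ^ k := by
    rw [← mul_pow]; norm_num
  calc ((2 : ℝ) ^ k)⁻¹ * ∑ S ∈ 𝒯, F S
      ≤ ((2 : ℝ) ^ k)⁻¹ * (1 + bigMass χ τ + 4 ^ k * τ) := by
        apply mul_le_mul_of_nonneg_left _ (inv_nonneg.mpr h2k.le)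
        rw [split]
        linarith [part1, part2, part3]
    _ = ((2 : ℝ) ^ k)⁻¹ * (1 + bigMass χ τ) + (2 : ℝ) ^ k * τ := by
        rw [h42]
        field_simp

/-- **U₂-free sufficient condition** ("sparse peak profile"): for every Clifford `U₁` and
Gaussian `U` there are a cut `k` and a threshold `τ` with
`2^{-k}(1 + bigMass_τ(U U₁ ĝ)) + 2^k τ ≤ 2^{-cn}`.  (With `τ = 4^{-γn}` and
`bigMass ≤ 2^{βn}`, `β < 2γ`, `β + 2γ ≤ 2`, the cut `k ≈ (β/2+γ)n` gives `c` just below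
`γ − β/2`; flat ĝ itself has `β = 0`, `γ = 1/2 − O(1/n)`.) -/
def SparsePeakProfile : Prop :=
  ∃ c : ℝ, 0 < c ∧ ∃ n₀ : ℕ, ∀ n ≥ n₀, ∀ (K : Type) [Field K] [Fintype K], Fintype.card K = 2 ^ n →
    ∀ e : K ≃+ (Fin n → ZMod 2), ∀ U₁ U : Matrix (QReg (n + n)) (QReg (n + n)) ℂ,
      U₁ ∈ Matrix.unitaryGroup (QReg (n + n)) ℂ → IsCliffordU U₁ →
      U ∈ Matrix.unitaryGroup (QReg (n + n)) ℂ → IsGaussianU U →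
      ∃ k ≤ n + n, ∃ τ : ℝ, 0 ≤ τ ∧
        ((2 : ℝ) ^ k)⁻¹ * (1 + bigMass (U *ᵥ (U₁ *ᵥ ghat n K e)) τ) + (2 : ℝ) ^ k * τ ≤
          (2 : ℝ) ^ (-(c * (n : ℝ)))

/-- **Reduction.** The sparse peak profile of the Gaussian images `U U₁ ĝ` implies the crux — for
EVERY Clifford `U₂`, i.e. for every symplectic flag of cuts. -/
theorem crux_of_sparsePeakProfile (h : SparsePeakProfile) : CompositeFrameBound := by
  obtain ⟨c, hc, n₀, H⟩ := h
  refine ⟨c, hc, n₀, fun n hn K _ _ hK e U₁ U₂ U hu1 hc1 hu2 hc2 hu hg => ?_⟩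
  obtain ⟨k, hk, τ, hτ, hprof⟩ := H n hn K hK e U₁ U hu1 hc1 hu hg
  refine ⟨k, hk, ?_⟩
  have hχ : star (U *ᵥ (U₁ *ᵥ ghat n K e)) ⬝ᵥ (U *ᵥ (U₁ *ᵥ ghat n K e)) = 1 := by
    rw [star_mulVec_dotProduct_mulVec hu, star_mulVec_dotProduct_mulVec hu1,
      star_ghat_dotProduct_ghat]
  exact (norm_cutPurity_mulVec_le _ hχ hc2 hu2 hk hτ).trans hprof


/-- **Sparse peaks** with explicit exponents: one Gaussian layer on a Clifford image of `ĝ`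
puts squared spectral mass at most `2^{βn}` on non-identity strings of squared expectation
`> 4^{-γn}`.  (Flat `ĝ` itself: mass `0` above `4^{-γn}` for every `γ < 1/2` and large `n`; the
gen-1 peel adds `O(1)`.)  A candidate replacement node for the crux: see `crux_of_sparsePeaks`. -/
def SparsePeaks (β γ : ℝ) : Prop :=
  ∃ n₀ : ℕ, ∀ n ≥ n₀, ∀ (K : Type) [Field K] [Fintype K], Fintype.card K = 2 ^ n →
    ∀ e : K ≃+ (Fin n → ZMod 2), ∀ U₁ U : Matrix (QReg (n + n)) (QReg (n + n)) ℂ,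
      U₁ ∈ Matrix.unitaryGroup (QReg (n + n)) ℂ → IsCliffordU U₁ →
      U ∈ Matrix.unitaryGroup (QReg (n + n)) ℂ → IsGaussianU U →
      bigMass (U *ᵥ (U₁ *ᵥ ghat n K e)) ((2 : ℝ) ^ (-(2 * γ * (n : ℝ)))) ≤ (2 : ℝ) ^ (β * (n : ℝ))

/-- The arithmetic of the cut choice: with `τ = 4^{-γn}`, `bigMass ≤ 2^{βn}` and
`k = ⌈(β/2+γ)n⌉`, the profile is `≤ 4·2^{-(γ-β/2)n}`. -/
theorem profile_arith {β γ : ℝ} (hβ : 0 ≤ β) (hγ : 0 ≤ γ) (n : ℕ) {B : ℝ} (hB0 : 0 ≤ B)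
    (hB : B ≤ (2 : ℝ) ^ (β * (n : ℝ))) :
    ((2 : ℝ) ^ ⌈(β / 2 + γ) * (n : ℝ)⌉₊)⁻¹ * (1 + B) +
        (2 : ℝ) ^ ⌈(β / 2 + γ) * (n : ℝ)⌉₊ * (2 : ℝ) ^ (-(2 * γ * (n : ℝ))) ≤
      4 * (2 : ℝ) ^ (-((γ - β / 2) * (n : ℝ))) := by
  set x : ℝ := (β / 2 + γ) * (n : ℝ) with hx
  set k : ℕ := ⌈x⌉₊ with hk
  have h2 : (1 : ℝ) ≤ 2 := by norm_num
  have hk1 : x ≤ (k : ℝ) := Nat.le_ceil x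
  have hpow : ((2 : ℝ) ^ k)⁻¹ = (2 : ℝ) ^ (-(k : ℝ)) := by
    rw [Real.rpow_neg (by norm_num), Real.rpow_natCast]
  have hkpow : (2 : ℝ) ^ k = (2 : ℝ) ^ (k : ℝ) := (Real.rpow_natCast 2 k).symm
  -- term 1
  have t1 : ((2 : ℝ) ^ k)⁻¹ * (1 + B) ≤ 2 * (2 : ℝ) ^ (-((γ - β / 2) * (n : ℝ))) := by
    rw [hpow]
    have hB' : 1 + B ≤ 2 * (2 : ℝ) ^ (β * (n : ℝ)) := by
      have : (1 : ℝ) ≤ (2 : ℝ) ^ (β * (n : ℝ)) := Real.one_le_rpow h2 (by positivity)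
      linarith
    calc (2 : ℝ) ^ (-(k : ℝ)) * (1 + B) ≤ (2 : ℝ) ^ (-x) * (2 * (2 : ℝ) ^ (β * (n : ℝ))) := by
          apply mul_le_mul (Real.rpow_le_rpow_of_exponent_le h2 (by linarith)) hB'
            (by positivity) (by positivity)
      _ = 2 * ((2 : ℝ) ^ (-x) * (2 : ℝ) ^ (β * (n : ℝ))) := by ring
      _ = 2 * (2 : ℝ) ^ (-((γ - β / 2) * (n : ℝ))) := by
          rw [← Real.rpow_add (by norm_num : (0 : ℝ) < 2)]
          congr 2
          rw [hx]; ring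
  -- term 2
  have t2 : (2 : ℝ) ^ k * (2 : ℝ) ^ (-(2 * γ * (n : ℝ))) ≤
      2 * (2 : ℝ) ^ (-((γ - β / 2) * (n : ℝ))) := by
    rw [hkpow]
    by_cases hxn : 0 ≤ x
    · have hk2 : (k : ℝ) < x + 1 := Nat.ceil_lt_add_one hxn
      calc (2 : ℝ) ^ (k : ℝ) * (2 : ℝ) ^ (-(2 * γ * (n : ℝ)))
          ≤ (2 : ℝ) ^ (x + 1) * (2 : ℝ) ^ (-(2 * γ * (n : ℝ))) := by
            apply mul_le_mul_of_nonneg_right (Real.rpow_le_rpow_of_exponent_le h2 hk2.le)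
            positivity
        _ = 2 * (2 : ℝ) ^ (-((γ - β / 2) * (n : ℝ))) := by
            rw [← Real.rpow_add (by norm_num : (0 : ℝ) < 2)]
            have : x + 1 + -(2 * γ * (n : ℝ)) = 1 + -((γ - β / 2) * (n : ℝ)) := by
              rw [hx]; ring
            rw [this, Real.rpow_add (by norm_num : (0 : ℝ) < 2), Real.rpow_one]
    · exact absurd (by positivity) hxn
  linarith [t1, t2]

/-- **Sparse peaks imply the crux**, with any `c < γ − β/2` (here `c = (γ − β/2)/2`):
the formal version of "the symplectic flag of U₂ costs only the count 4^k". -/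
theorem crux_of_sparsePeaks {β γ : ℝ} (hβ : 0 ≤ β) (hβγ : β < 2 * γ) (h1 : β / 2 + γ ≤ 1)
    (h : SparsePeaks β γ) : CompositeFrameBound := by
  apply crux_of_sparsePeakProfile
  obtain ⟨n₀, H⟩ := h
  set d : ℝ := γ - β / 2 with hd
  have hdpos : 0 < d := by rw [hd]; linarith
  refine ⟨d / 2, by positivity, max n₀ (⌈4 / d⌉₊ + 1), fun n hn K _ _ hK e U₁ U hu1 hc1 hu hg => ?_⟩
  have hn₀ : n₀ ≤ n := (le_max_left _ _).trans hn
  have hn4 : 4 / d ≤ (n : ℝ) := by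
    have h' : ⌈4 / d⌉₊ + 1 ≤ n := (le_max_right _ _).trans hn
    have : (⌈4 / d⌉₊ : ℝ) ≤ n := by exact_mod_cast (Nat.le_succ _).trans h'
    exact (Nat.le_ceil _).trans this
  refine ⟨⌈(β / 2 + γ) * (n : ℝ)⌉₊, ?_, (2 : ℝ) ^ (-(2 * γ * (n : ℝ))), by positivity, ?_⟩
  · -- k ≤ n ≤ n + n
    have : ⌈(β / 2 + γ) * (n : ℝ)⌉₊ ≤ n := by
      rw [Nat.ceil_le]
      calc (β / 2 + γ) * (n : ℝ) ≤ 1 * (n : ℝ) := by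
            apply mul_le_mul_of_nonneg_right h1 (Nat.cast_nonneg n)
        _ = n := one_mul _
    omega
  · have hB := H n hn₀ K hK e U₁ U hu1 hc1 hu hg
    refine (profile_arith hβ (by linarith) n (bigMass_nonneg _ _) hB).trans ?_
    -- 4 · 2^{-dn} ≤ 2^{-(d/2) n}  since  d n / 2 ≥ 2
    have hdn : 2 ≤ d / 2 * (n : ℝ) := by
      have := (div_le_iff₀ hdpos).mp hn4
      linarith
    calc 4 * (2 : ℝ) ^ (-((γ - β / 2) * (n : ℝ))) = (2 : ℝ) ^ (2 + -(d * (n : ℝ))) := by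
          rw [Real.rpow_add (by norm_num : (0 : ℝ) < 2), hd]
          norm_num
      _ ≤ (2 : ℝ) ^ (-(d / 2 * (n : ℝ))) :=
          Real.rpow_le_rpow_of_exponent_le (by norm_num) (by linarith)


/-! ## §6 Findings in prose (gen 2): why the crux resists, what would kill it, lines

Notation: `N = 2n` wires, Paulis mod phase `≅ 𝔽₂^{4n}` with the commutator symplectic form;
`L₀` = the diagonal (Z-type) strings, a Lagrangian; spectrum of `ĝ` (items GraphStateSpectrum +
CubeAlmostBent, both provable-now): `⟨Z^{(α,β)}⟩ = W_F(α,β)/2ⁿ` with `|W_F| ≤ L = 2^{⌊n/2⌋+1}`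
for `β ≠ 0` and `= [α = 0]` for `β = 0`; strings with value-register X-part `a' ≠ 0` and data
X-part `a = 0` have `⟨·⟩ = 0`; strings with `a ≠ 0` have `|⟨·⟩| ≤ Δ/2ⁿ = 2^{1-n}` (APN).
So: BIG values (`≤ L/2ⁿ ≈ 2^{(1-n)/2}`) live on the Lagrangian `L₀` only; everything off `L₀` is
THIN (`≤ 2^{1-n}`); total squared mass `Σ_P ⟨P⟩² = 2^{2n}`, of which `2ⁿ` sits on `L₀`.

### 6.1 Depth-1 RIGIDITY of ĝ (new; paper proof, 6 lines; strengthens the m = 0 case of 10729)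
CLAIM. For every Clifford unitary `V` on the `2n` wires (no ancillas) and every `k`,
`purity_k(V ĝ) ≤ 9 · 2^{-min(k, 2n-k)}` (`7·` for odd `n`): EVERY cut of EVERY Clifford image of
`ĝ` is within `log₂ 9` bits of maximally entangled.  PROOF. `purity_A = 2^{-a} Σ_{P ∈ W} ⟨P⟩²_ĝ`
(§3) with `W = V† 𝒫_A V` a NON-DEGENERATE symplectic subspace of dimension `2a`, `a = |A|`;
`W ∩ L₀` is isotropic inside `W`, hence `|W ∩ L₀| ≤ 2^a`; so
`purity_A ≤ 2^{-a}[1 + (2^a-1)L²/4ⁿ + 4^a Δ²/4ⁿ] ≤ 2^{-a} + 2^{2-n} + 2^{a+2-2n} ≤ 9·2^{-a}` for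
`a ≤ n`, and `purity(A) = purity(Ā)` handles `a > n`. ∎  READING: at depth 1 the crux holds with
`c = 1` and NOTHING moves; the obstruction is symplectic-geometric (isotropic sets inside a
symplectic `W` are small), not a shortage of mass (`L₀` alone carries mass `2ⁿ`, enough for
purity `1` at the middle cut if it could sit inside `𝒫_A` — it cannot, being commutative).
Everything a depth-3 frame can do is therefore done by the Gaussian layer moving mass OFF the
"Lagrangian + thin" shape.  (With `m` clean ancillas this rigidity fails — cleaning — which is why
10729 only claims SOME cut `≤ 4ε`.)

### 6.2 The U₂-free reduction (PROVED, §5) and the two-sided dichotomy it yields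
`crux_of_sparsePeakProfile`, `crux_of_sparsePeaks`: for unit `χ` and ANY Clifford `U₂`,
`purity_k(U₂χ) ≤ 2^{-k}(1 + bigMass_τ(χ)) + 2^k τ`.  Hence, writing `v₁ ≥ v₂ ≥ …` for the sorted
squared non-identity expectations of the Gaussian image `χ = U U₁ ĝ` and `T_K = Σ_{i≤K} v_i`:
* SUFFICIENT for the crux: `SparsePeaks β γ` (mass above `4^{-γn}` is `≤ 2^{βn}`) with `β < 2γ`,
  `β/2 + γ ≤ 1` — then `c = (γ-β/2)/2` (proved).  Flat `ĝ`: `β = 0`, any `γ < 1/2`.  The gen-1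
  PEEL (exact `|⟨P⟩| = 1/√2` for two strings) has `bigMass ≤ 2`: harmless.  So the flatness route
  is dead (gen 1) but its sparse-peak weakening is alive and is exactly what provers should aim at.
* NECESSARY for a kill (any refuting frame family): `T_{4^k-1}(χ) ≥ 2^{k-o(n)} - 1` for EVERY
  `k ≤ n` simultaneously (and symmetrically for the complement side), i.e. one Gaussian layer must
  lift `~2^k` strings to squared expectation `~2^{-o(n)}·(2^k/4^k)`… concretely at `k = n/2`:
  `2^{n}` strings of squared expectation `≳ 2^{-n/2}`, a `2^{n/2}`-fold concentration above flat,
  for exponentially many strings at once.  Known mechanisms deliver `O(1)` such strings (peel).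
  NB for `ĝ` ITSELF `T_{4^k}(ĝ) = 4^k · 2^{1-n}` (`k < n`, odd `n`): the necessary condition already
  FAILS for every `k < n - 1` — consistent with 6.1.

### 6.3 Structure of the T-sandwich (Clifford ∘ diagonal-Gaussian ∘ Clifford) — coset transform
Let `Q_j = U₁† Z_j U₁` (a basis of the Lagrangian `L = U₁† 𝒵 U₁`), `U = ⊗_j e^{iθ_j Z_j}` (the
block rotation `R = ⊕_j Rot(2θ_j)`, a maximal torus of SO(4n); T-layers are `θ_j = π/8`).  Then
`U U₁ = U₁ Ũ`, `Ũ = Π_j e^{iθ_j Q_j}`, and for every Pauli `P`, with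
`J(P) = {j : P Q_j = -Q_j P}`:
`⟨P Q_{S₀}⟩_{Ũĝ} = Σ_{S ⊆ J(P)} (⊗_{j∈J(P)} e^{2iθ_j X})_{S₀,S} · ⟨P Q_S⟩_ĝ`
— the diagonal layer acts on the spectrum of `ĝ` as a BLOCK-UNITARY, one block per coset
`P·⟨Q_j : j ∈ J(P)⟩` (note `J(P Q_S) = J(P)`), each block a tensor power of `2×2` rotations.
Consequences: (i) squared mass is conserved coset by coset; (ii) at `θ ≡ π/8`,
`|⟨P⟩_after| ≤ 2^{-|J(P)|/2} Σ_{S} |⟨P Q_S⟩_ĝ|`, so a coset meeting the big set `L₀` in `s`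
strings of size `2^{(1-n)/2}` yields at most `s·2^{(1-n)/2}·2^{-|J|/2}`; (iii) an EXACT peel needs
the input vector on a coset to be a column of the tensor transform: full support `2^{|J|}`,
constant modulus, product-structured phases.  For `ĝ` this happens precisely when the coset is
`(Walsh flat of one component β) ∪ (that flat)·E` with `|J| = n`: the flat is an affine
hyperplane of `2^{n-1}` strings `Z^{(α,β)}` with values `±2^{-(n-1)/2}` and quadratic signs
(near-bent Gold component), `E` an extra anticommuting generator — output `2^{n-1}·2^{-(n-1)/2}·
2^{-n/2} = 2^{-1/2}`: this IS gen 1's `1/√2` peel, now explained as a coset resonance.  Two flats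
`β ≠ β'` need generator sets spanning `Z(H_β) + Z(H_β') =` all data-register Z's plus extras, and
the anticommutation patterns `J(P_β)`, `J(P_β')` must each cut out exactly their own flat: this is
the shared-generator budget behind gen 1's "≤ 2 exact peels per T-layer".  (The coset-transform
formula, per-coset mass conservation and the spectral facts of `ĝ` used in 6.1 were verified to
machine precision at `n = 3`, all cosets of 40 random strings, `U₁ = H` on the value register,
`θ ≡ π/8`: folder `compute/coset_check.py`, pure Python; that particular frame creates NO peak —
max `⟨P⟩² = 1/8` below the flat level `1/4` — peaks need gen 1's designed frames.)  No T-sandwich mechanism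
producing `2^{Ω(n)}` simultaneous peaks is known; none is excluded either.  The X-sector input
on a coset is explicit: for the Hermitian string `P = i^{|A∧b|} X^A Z^b`, `A = (a,a')`, `a ≠ 0`,
`⟨P⟩_ĝ = 2^{1-n} · i^{|A∧b|} · (-1)^{b·z₀} · [|A∧b| even]` if `F(x₀+a) = F(x₀)+a'` is solvable
(`z₀ = (x₀, F(x₀))`, `x₀` a root of `a x₀² + a² x₀ = a' + a³`), and `0` otherwise — half support,
a character sign in `b` times the quadratic sign `(-1)^{C(|A∧b|,2)}`, and the nonlinearity sits in
`(a,a') ↦ z₀(a,a')`.  In the computational frame (`U₁ = 1`, T-layer straight on `ĝ`) this produces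
NO value above `ĝ`'s own maximum (`n = 3, 4`, all `4^{2n}` strings: folder
`compute/tlayer_identity.py`); the peel needs gen 1's designed frames.
Nearest print for this architecture (simulability side, no lower bounds): Deger–Koutsioumpas–
Webster–Sayginel–Roffe–Browne, arXiv:2607.08396 (2026): Clifford encoder ∘ transversal diagonal ∘
permutation circuits ARE MPS-simulable by Clifford push-back — i.e. T-sandwich frames are exactly
what a 2026 simulator would try first on `ĝ`; gen 1's ancilla refutation (T-depth 1 with O(n²)
clean qubits) says they succeed WITH ancillas, and the typed crux asks whether they can in place.

### 6.4 Why general SO(4n) middle layers are genuinely richer (and genuinely open)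
A general `R` maps a degree-`d` monomial onto up to `C(4n,d)` monomials (vs `2^{|J|} ≤ 4ⁿ` for the
torus), with Plücker coefficients `det R_{T,T'}` that can be as flat as `(d/4n)^{d/2}`; Cauchy–
Schwarz only gives `|⟨P⟩_after| ≤ ε·C(4n,d)^{1/2}`, vacuous for `d ≳ 0.21·4n`.  So nothing
spectral forbids a general Gaussian from assembling `2^{Ω(n)}` peaks out of the THIN X-sector; no
mechanism is known that does (it would have to correlate minors of one orthogonal `R` with the
algebraic sign pattern above on `2^{Θ(n)}` cosets at once).  Gen-1 numerics (n ≤ 5, Adam over all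
Givens angles): best min-cut purity `0.84 / 0.48 / 0.15` for `n = 3/4/5` — decaying, below even the
depth-1 ceiling `9·2^{-n}` only from `n ≥ 7` on, so small `n` cannot inform the asymptotics.

### 6.5 Exact disentangling (to a basis state) — extra arithmetic constraints (remarks)
If `U U₁ ĝ = |s⟩` (stabilizer) then, degree by degree in the Majorana frame, the Gaussian-invariant
masses `m_d(U₁ĝ) = Σ_{|T|=d} ⟨c_T⟩² = |Σ_d(s)| ∈ ℕ`; for `C(4n,d) < 2^{n-2}` (`d < 0.166n` or
`d > 4n - 0.166n`) flatness forces `m_d = 0`: `U₁` must send every JW monomial of those degrees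
into the ZERO set of `ĝ`'s spectrum, and `M(U₁ĝ) = 0` (gen 1 / g41-31).  Counting alone gives no
contradiction (a rate-3/4 binary code of relative distance 0.0415 exists — the same entropy
coincidence `H(1/24·…)`), so even exact in-place disentangling is not excluded by spectra.

### 6.6 Typing remarks
* `IsCliffordU` is one-sided (`U S U† ∝ S'`) but inverse-closed given unitarity (`isCliffordU_star`,
  proved): no loss.  `IsCliffordU U` alone forces `U` unitary (take `S = I`: `UU† = c·S'`, PSD ⇒
  `S' = I, c = 1`).  `IsGaussianU U` alone does NOT: `U = exp(tΓ/2)`, `Γ = Z^{⊗N}`, satisfies it with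
  `R = 1` (Γ anticommutes with every Majorana) and is not unitary — the crux's separate unitarity
  hypothesis on `U` is therefore needed as typed (correcting a gen-1 aside that all three are
  redundant; harmless either way).
* `∀ e` is absorbed by `∀ U₁` (e ↦ A∘e is a CNOT relabelling); `n = 0` is vacuous (no field of
  order 1); trivial cuts `k ∈ {0, 2n}` have purity exactly 1 (gen 1 `crux_iff_interior`).

### 6.7 Attack ledger (cumulative) and status
gen 1: load-bearing drops (each layer's structure needed) ✓ re-proved here; ancilla version FALSE
(T-depth-1, Selinger) — filed as AncillaRefutation.md; diagonal-Gaussian full disentangling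
impossible in place (parity count ≥ 2n ancillas); peel = exact 1/√2 peak, ≤ 2 per T-layer;
flatness-preservation route DEAD; numerics n ≤ 5.  gen 2: purity = spectral mass PROVED for the
typed sum; U₂ eliminated (PROVED reduction to SparsePeakProfile / SparsePeaks β γ); depth-1
rigidity `9·2^{-min(k,2n-k)}` (paper); coset-transform structure of T-sandwiches (paper) explaining
the peel; exact-disentangling integrality constraints; typing remarks; literature 2026 (no depth-3
bound or disentangler in print; local searchd index was DOWN this session, OpenAlex tier used).
VERDICT: no kill; the crux is OPEN IN SUBSTANCE; the refuter's necessary condition (6.2) pins what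
a kill must do.  LANDING: §0–§2 proposed as `Theorems/CompositeFrameBound/Negative/LoadBearing.lean`
(p71925, review-queued: new defs); `Negative/SpectralMass.lean` (§3–§4) and `Negative/SparsePeaks.lean`
(§5) import it and are ready in the gen-2 folder, to be proposed on its acceptance (a first attempt,
p71871, bounced because parameterless `def … : Prop` weakenings were auto-relocated to Literature/ —
they are now inlined in the theorem types).

### 6.8 Lines
PROVERS: do not try to preserve flatness; prove `SparsePeaks β γ` (then `crux_of_sparsePeaks`),
first for the torus/T-sandwich sub-family via the coset transform (6.3: bound the number of cosets
whose input vector is within angle `2^{-o(n)}` of a tensor column — a statement about Walsh flats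
of the Gold components and the X-sector sign pattern), then for general `R` (open; needs an idea).
PLANNER: if re-cruxing, `SparsePeakProfile` (or `SparsePeaks β γ` with e.g. `β = 1/2, γ = 0.45`)
is the natural U₂-free replacement node — it implies the crux (proved here) and is the weakest
spectral statement not already refuted by peeling.  IDEATORS: the kill, if any, is a Gaussian `R`
whose minors resonate with `(a,a') ↦ z₀(a,a')` (half-trace / quadratic-solving over GF(2ⁿ)) on
exponentially many cosets; the Z-sector alone can never suffice beyond the middle cut (mass `2ⁿ`).
-/

end Summit.QuantumAdvantage.QuantumAdvantage.Cruxes.CompositeFrameBound.Disproof
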